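import Summits.CriticalPhenomena.PercolationContinuityZ3.Theorems.PercNearOneGluingNoHeavyLowerTailTformLightStarInduction
import HarnessLib

/-!
# `NoHeavyLowerTail` (stmt-CriticalPhenomena-4575) — corollaries of the light-star induction: XZ at every champion for graphs whose
# non-relay vertices span a matching (unconditional), and the crux reduced to light MULTI-star packing

Support file (prover `prim-hp-5`, hull-port cell, T-form calculus, gen 3; `--supports stmt-CriticalPhenomena-4575`).
No definitions, no named facts, no sorries.  See `…TformLightStarInduction` (`Theorems.xzDeficit_induction`) for the induction and
the notation.  LIGHT MULTI-STAR PACKING (hypothesis `hLSP2`): for a weighted graph `w`, relays `A`, an observer `o ∉ A` with a set `B`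
of at least two non-relay positive-weight neighbours, and — in the graph `u` with the pairs at `o` switched off — a champion `q` strictly
heavier than every member of `B` and any relay `c`:
    `μ_u(q ≁ B, 1 ≤ |π(B)| ≤ j) + μ_u(|π(B)| = 0, |π(c)| ≤ j) ≤ μ_u(q ≁ B, |π(q)| ≤ j)`.
(0 violations in this seat's exact census, `lab/lsp_test.py` / `lab/pst_champ.py`; for `c = q` it is the ttrl census TCS.)

* `attachedChampion_of_lightMultiStarPacking` — `hLSP2` ⇒ the registered stub `stub_attachedChampion` verbatim;
  `noHeavyLowerTail_of_lightMultiStarPacking` — ⇒ the crux.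
* `attachedChampion_of_steinerMatching` — **UNCONDITIONAL: if every non-relay vertex of `w` has at most one non-relay positive-weight
  neighbour (the non-relay vertices span a matching; relays and their pairs arbitrary), then for every observer `o ∉ A` and every
  level-`j` champion `q`: `μ{1 ≤ N ≤ j} ≤ μ({|π(q)| ≤ j} ∩ {1 ≤ N})`** (no light multi-star can occur in the induction), and hence
  `cumulativeIsolation_of_steinerMatching`: the registered stub `stub_cumulativeIsolation` on this class.  Previously known sub-cases:
  relay-neighboured observers (`SinglePortDomination`, prim-lf-8), one relay-neighboured Steiner neighbour (`Theorems.cil_oneSteiner`,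
  CIL only), Steiner paths / separated hulls (gen 2 of this seat, ∃-witness only).
-/

noncomputable section

namespace Summit.CriticalPhenomena.PercolationContinuityZ3.Theorems

open MeasureTheory Set Literature.Probability.LatticeModels Literature.Probability.Percolation
open scoped Classical BigOperators

/-- **Light multi-star packing implies the attached-champion inequality (every observer, every graph).**  Conclusion = the
registered stub `stub_attachedChampion` verbatim. [cite: VandenbergHaggstromKahn2005, Thm. 1.5 (p. 7); KozmaNitzan2024, Lemma 5 (p. 13)] -/
theorem attachedChampion_of_lightMultiStarPacking
    (hLSP2 : ∀ (n : ℕ) (w : Sym2 (Fin n) → unitInterval) (A B : Finset (Fin n)) (o q c : Fin n) (j : ℕ),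
      o ∉ A → q ∈ A → c ∈ A → 2 ≤ B.card → (∀ y ∈ B, y ∉ A ∧ y ≠ o ∧ w s(o, y) ≠ 0) →
      (∀ a ∈ A, (prodBernoulli fun e => if e ∈ {e : Sym2 (Fin n) | o ∉ e} then w e else 0).real
          {ξ : BondConfig (Fin n) | (A.filter fun z => (openGraph ξ).Reachable a z).card ≤ j} ≤
        (prodBernoulli fun e => if e ∈ {e : Sym2 (Fin n) | o ∉ e} then w e else 0).real
          {ξ : BondConfig (Fin n) | (A.filter fun z => (openGraph ξ).Reachable q z).card ≤ j}) →
      (∀ y ∈ B, (prodBernoulli fun e => if e ∈ {e : Sym2 (Fin n) | o ∉ e} then w e else 0).real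
          {ξ : BondConfig (Fin n) | (A.filter fun z => (openGraph ξ).Reachable q z).card ≤ j} <
        (prodBernoulli fun e => if e ∈ {e : Sym2 (Fin n) | o ∉ e} then w e else 0).real
          {ξ : BondConfig (Fin n) | (A.filter fun z => (openGraph ξ).Reachable y z).card ≤ j}) →
      (prodBernoulli fun e => if e ∈ {e : Sym2 (Fin n) | o ∉ e} then w e else 0).real {ξ : BondConfig (Fin n) |
          (∀ y ∈ B, ¬ (openGraph ξ).Reachable q y) ∧
            1 ≤ (A.filter fun z => ∃ y ∈ B, (openGraph ξ).Reachable y z).card ∧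
            (A.filter fun z => ∃ y ∈ B, (openGraph ξ).Reachable y z).card ≤ j} +
        (prodBernoulli fun e => if e ∈ {e : Sym2 (Fin n) | o ∉ e} then w e else 0).real {ξ : BondConfig (Fin n) |
          ¬ 1 ≤ (A.filter fun z => ∃ y ∈ B, (openGraph ξ).Reachable y z).card ∧
            (A.filter fun z => (openGraph ξ).Reachable c z).card ≤ j} ≤
      (prodBernoulli fun e => if e ∈ {e : Sym2 (Fin n) | o ∉ e} then w e else 0).real {ξ : BondConfig (Fin n) |
          (∀ y ∈ B, ¬ (openGraph ξ).Reachable q y) ∧ (A.filter fun z => (openGraph ξ).Reachable q z).card ≤ j})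
    (n : ℕ) (w : Sym2 (Fin n) → unitInterval) (A : Finset (Fin n)) (o q : Fin n) (j : ℕ) (ho : o ∉ A) (hq : q ∈ A)
    (hchamp : ∀ a ∈ A,
      (prodBernoulli w).real {ω : BondConfig (Fin n) | (A.filter fun x => ω ∈ openConn a x).card ≤ j} ≤
        (prodBernoulli w).real {ω : BondConfig (Fin n) | (A.filter fun x => ω ∈ openConn q x).card ≤ j}) :
    (prodBernoulli w).real {ω : BondConfig (Fin n) |
        1 ≤ (A.filter fun x => ω ∈ openConn o x).card ∧ (A.filter fun x => ω ∈ openConn o x).card ≤ j} ≤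
      (prodBernoulli w).real {ω : BondConfig (Fin n) |
        (A.filter fun x => ω ∈ openConn q x).card ≤ j ∧ 1 ≤ (A.filter fun x => ω ∈ openConn o x).card} := by
  have h := xzDeficit_induction (fun _ _ _ => True) (fun _ _ _ _ _ => trivial)
    (fun n w A B o q c j _ ho hq hc hB hBy hch hl => hLSP2 n w A B o q c j ho hq hc hB hBy hch hl)
    ((Finset.univ.filter fun e : Sym2 (Fin n) => w e ≠ 0).card) n w A o q q j le_rfl trivial ho hq hq hchamp
  linarith

/-- **Light multi-star packing closes the crux `NoHeavyLowerTail`.** -/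
theorem noHeavyLowerTail_of_lightMultiStarPacking
    (hLSP2 : ∀ (n : ℕ) (w : Sym2 (Fin n) → unitInterval) (A B : Finset (Fin n)) (o q c : Fin n) (j : ℕ),
      o ∉ A → q ∈ A → c ∈ A → 2 ≤ B.card → (∀ y ∈ B, y ∉ A ∧ y ≠ o ∧ w s(o, y) ≠ 0) →
      (∀ a ∈ A, (prodBernoulli fun e => if e ∈ {e : Sym2 (Fin n) | o ∉ e} then w e else 0).real
          {ξ : BondConfig (Fin n) | (A.filter fun z => (openGraph ξ).Reachable a z).card ≤ j} ≤
        (prodBernoulli fun e => if e ∈ {e : Sym2 (Fin n) | o ∉ e} then w e else 0).real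
          {ξ : BondConfig (Fin n) | (A.filter fun z => (openGraph ξ).Reachable q z).card ≤ j}) →
      (∀ y ∈ B, (prodBernoulli fun e => if e ∈ {e : Sym2 (Fin n) | o ∉ e} then w e else 0).real
          {ξ : BondConfig (Fin n) | (A.filter fun z => (openGraph ξ).Reachable q z).card ≤ j} <
        (prodBernoulli fun e => if e ∈ {e : Sym2 (Fin n) | o ∉ e} then w e else 0).real
          {ξ : BondConfig (Fin n) | (A.filter fun z => (openGraph ξ).Reachable y z).card ≤ j}) →
      (prodBernoulli fun e => if e ∈ {e : Sym2 (Fin n) | o ∉ e} then w e else 0).real {ξ : BondConfig (Fin n) |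
          (∀ y ∈ B, ¬ (openGraph ξ).Reachable q y) ∧
            1 ≤ (A.filter fun z => ∃ y ∈ B, (openGraph ξ).Reachable y z).card ∧
            (A.filter fun z => ∃ y ∈ B, (openGraph ξ).Reachable y z).card ≤ j} +
        (prodBernoulli fun e => if e ∈ {e : Sym2 (Fin n) | o ∉ e} then w e else 0).real {ξ : BondConfig (Fin n) |
          ¬ 1 ≤ (A.filter fun z => ∃ y ∈ B, (openGraph ξ).Reachable y z).card ∧
            (A.filter fun z => (openGraph ξ).Reachable c z).card ≤ j} ≤
      (prodBernoulli fun e => if e ∈ {e : Sym2 (Fin n) | o ∉ e} then w e else 0).real {ξ : BondConfig (Fin n) |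
          (∀ y ∈ B, ¬ (openGraph ξ).Reachable q y) ∧ (A.filter fun z => (openGraph ξ).Reachable q z).card ≤ j}) :
    Summit.CriticalPhenomena.PercolationContinuityZ3.Theses.PercNearOneGluing.NoHeavyLowerTail :=
  noHeavyLowerTail_of_attachedChampion fun n w A o q j ho hq hchamp =>
    attachedChampion_of_lightMultiStarPacking hLSP2 n w A o q j ho hq hchamp

/-- **XZ at the champion when the non-relay vertices span a matching (unconditional).**  If every non-relay vertex `v` of `w` has
at most one non-relay positive-weight neighbour other than itself, then for every observer `o ∉ A`, every level `j` and every
champion `q ∈ A`: `μ{1 ≤ N ≤ j} ≤ μ({|π(q)| ≤ j} ∩ {1 ≤ N})` — the registered stub `stub_attachedChampion` at `(w, A, o, q, j)`.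
[cite: VandenbergHaggstromKahn2005, Thm. 1.5 (p. 7); KozmaNitzan2024, Lemma 5 (p. 13)] -/
theorem attachedChampion_of_steinerMatching (n : ℕ) (w : Sym2 (Fin n) → unitInterval) (A : Finset (Fin n)) (o q : Fin n)
    (j : ℕ) (ho : o ∉ A) (hq : q ∈ A)
    (hmatch : ∀ v : Fin n, v ∉ A → (Finset.univ.filter fun y : Fin n => y ∉ A ∧ y ≠ v ∧ w s(v, y) ≠ 0).card ≤ 1)
    (hchamp : ∀ a ∈ A,
      (prodBernoulli w).real {ω : BondConfig (Fin n) | (A.filter fun x => ω ∈ openConn a x).card ≤ j} ≤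
        (prodBernoulli w).real {ω : BondConfig (Fin n) | (A.filter fun x => ω ∈ openConn q x).card ≤ j}) :
    (prodBernoulli w).real {ω : BondConfig (Fin n) |
        1 ≤ (A.filter fun x => ω ∈ openConn o x).card ∧ (A.filter fun x => ω ∈ openConn o x).card ≤ j} ≤
      (prodBernoulli w).real {ω : BondConfig (Fin n) |
        (A.filter fun x => ω ∈ openConn q x).card ≤ j ∧ 1 ≤ (A.filter fun x => ω ∈ openConn o x).card} := by
  -- the class: non-relay vertices have at most one non-relay neighbour; closed under switching pairs off
  have h := xzDeficit_induction
    (fun n w A => ∀ v : Fin n, v ∉ A → (Finset.univ.filter fun y : Fin n => y ∉ A ∧ y ≠ v ∧ w s(v, y) ≠ 0).card ≤ 1)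
    (by
      intro n w A o hCw v hv
      refine le_trans (Finset.card_le_card fun y hy => ?_) (hCw v hv)
      rw [Finset.mem_filter] at hy ⊢
      refine ⟨hy.1, hy.2.1, hy.2.2.1, fun h0 => hy.2.2.2 ?_⟩
      simp only [mem_setOf_eq]
      split_ifs <;> simp [h0])
    (by
      intro n w A B o q c j hCw ho _ _ hB hBy _ _
      -- two non-relay neighbours of `o` contradict the matching hypothesis
      exfalso
      have hsub : B ⊆ Finset.univ.filter fun y : Fin n => y ∉ A ∧ y ≠ o ∧ w s(o, y) ≠ 0 := by
        intro y hy
        exact Finset.mem_filter.2 ⟨Finset.mem_univ _, hBy y hy⟩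
      have := (Finset.card_le_card hsub).trans (hCw o ho)
      omega)
    ((Finset.univ.filter fun e : Sym2 (Fin n) => w e ≠ 0).card) n w A o q q j le_rfl hmatch ho hq hq hchamp
  linarith

open MergeStability in
/-- **CIL when the non-relay vertices span a matching** — the registered stub `stub_cumulativeIsolation` on this class:
some `a ∈ A` (a champion) satisfies `μ{1 ≤ N ≤ j} ≤ μ{|π(a)| ≤ j}`. -/
theorem cumulativeIsolation_of_steinerMatching (n : ℕ) (w : Sym2 (Fin n) → unitInterval) (A : Finset (Fin n)) (o : Fin n)
    (j : ℕ) (hA : A.Nonempty) (ho : o ∉ A)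
    (hmatch : ∀ v : Fin n, v ∉ A → (Finset.univ.filter fun y : Fin n => y ∉ A ∧ y ≠ v ∧ w s(v, y) ≠ 0).card ≤ 1) :
    ∃ a ∈ A,
      (prodBernoulli w).real {ω : BondConfig (Fin n) |
          1 ≤ (A.filter fun x => ω ∈ openConn o x).card ∧ (A.filter fun x => ω ∈ openConn o x).card ≤ j} ≤
        (prodBernoulli w).real {ω : BondConfig (Fin n) | (A.filter fun x => ω ∈ openConn a x).card ≤ j} := by
  obtain ⟨q, hq, hchamp⟩ := exists_champion (prodBernoulli w) A hA j
  refine ⟨q, hq, (attachedChampion_of_steinerMatching n w A o q j ho hq hmatch hchamp).trans ?_⟩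
  exact measureReal_mono (fun ω hω => hω.1) (measure_ne_top _ _)

end Summit.CriticalPhenomena.PercolationContinuityZ3.Theorems

end
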